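import Mathlib.Topology.Algebra.OpenSubgroup
import Mathlib.Topology.Algebra.MulAction
import Mathlib.GroupTheory.GroupAction.Blocks
import Mathlib.Topology.LocallyConstant.Basic
import Mathlib.Topology.Algebra.Support
import Mathlib.Algebra.BigOperators.Group.Finset.Basic
import Mathlib.Algebra.Group.Indicator
import HarnessLib
/-!
# Orbit cells of an open subgroup: locally constant compactly supported functions on a `G`-space are finite sums of
# indicators of orbits of a small open subgroup

Topic `Topology`; namespace `Literature.Topology`.  THEOREMS ONLY (no definition, no instance, no notation, no named fact, no `sorry`);
folklore of `ℓ`-spaces (Bernstein–Zelevinsky 1976 §1: a function in `S(X)` on an `ℓ`-space with a continuous action of an `ℓ`-group is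
invariant under a compact open subgroup; the orbits of an open subgroup are open and partition every invariant compact open set into finitely
many cells).  Cell `pub/hodgecm-mathlib` (D-0151), crux H413 = `stmt-HodgeConjecture-24833`, line LH4 (closer stub `stub_N6ns`, PRINT residual
`stub_N6nsShalika` = [Rogawski1990, Prop. 8.1.1]), Shalika sub-road LAYER 2 organ «COINV-1» (uniqueness of invariant functionals on the test functions
of ONE orbit), FILE 1 of 2 (the cells); FILE 2 `Literature/MeasureTheory/Group/InvariantFunctionalLocallyConstant.lean` draws the uniqueness.
HONEST LABEL: pure topology; HC_CM is proved only modulo the 7 printed citations (2 remaining: hLiu418 = stmt-HodgeConjecture-24832, h413 =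
stmt-HodgeConjecture-24833) until rung 0 closes; this file pays no letter.

THE MATHEMATICS.  `G` a topological group acting continuously (`ContinuousSMul`) on a topological space `X`.
* §1 UNIFORM INVARIANCE: a locally constant compactly supported `F : X → Y` is invariant under a neighbourhood of `1`:
  `∃ V ∈ 𝓝 1, ∀ x, ∀ v ∈ V, F (v • x) = F x` (generalised tube lemma on `tsupport F ×ˢ {1}`), hence under a member of any family of sets entering
  every neighbourhood of `1` (e.g. the open subgroups `N ≤ K₀` normalised by a compact open subgroup `K₀`, ★ `Literature/Topology/Algebra/CompactOpenSubgroupTrace`).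
* §2 CELLS: if the orbit maps `g ↦ g • x` are OPEN (a quotient `G ⧸ H`; an orbit of a σ-compact group in a Baire space, Mathlib
  `isOpenMap_smul_of_sigmaCompact`), the orbits of an OPEN subgroup `N` are open, and closed (the complement is a union of orbits); the orbits of a
  compact subgroup are compact; an `N`-stable compact set contains only FINITELY many `N`-orbits and is their disjoint union.
* §3 DECOMPOSITION: an `N`-invariant locally constant compactly supported `F` is the finite sum `F = Σ_ω 1_{ω} · F(ω)` over the `N`-orbits `ω` meeting
  its support; with §1, every `F ∈ S(X)` has this shape for some open `N ≤ K₀` normalised by `K₀`.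
* §4 NORMAL REFINEMENT: for an open subgroup `N ≤ M` normalised by `M`, every `N`-orbit inside `M • x` is an `M`-TRANSLATE `m • (N • x)` of the
  `N`-orbit of `x`, and `M • x` (compact when `M` is) is the disjoint union of finitely many of them — the counting step behind the uniqueness of
  invariant functionals (FILE 2) and of invariant measures on the cells.

## References
* [BernsteinZelevinsky1976] I. N. Bernstein, A. V. Zelevinsky, *Representations of the group GL(n, F) where F is a non-archimedean local field*,
  Russian Math. Surveys 31:3 (1976) 1–68: §1.1–§1.6 (`ℓ`-spaces, `S(X)`, actions of `ℓ`-groups), Prop. 1.18 ff. (invariant distributions on homogeneous spaces).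
-/

set_option autoImplicit false

open Set Filter Topology MulAction
open scoped Pointwise

namespace Literature.Topology

/-! ## §1 Uniform invariance of `S(X)` under a neighbourhood of `1` -/

section Uniform

variable {G : Type*} [Group G] [TopologicalSpace G] [IsTopologicalGroup G]
  {X : Type*} [TopologicalSpace X] [MulAction G X] [ContinuousSMul G X] {Y : Type*} [Zero Y]

/-- **UNIFORM INVARIANCE.**  A locally constant compactly supported function on a `G`-space (continuous action) is invariant under a
neighbourhood of `1`: `∃ V ∈ 𝓝 1, ∀ x, ∀ v ∈ V, F (v • x) = F x`. [cite: BernsteinZelevinsky1976, §1.1] -/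
theorem exists_nhds_one_forall_smul_eq_of_hasCompactSupport {F : X → Y} (hF : IsLocallyConstant F) (hFs : HasCompactSupport F) :
    ∃ V ∈ 𝓝 (1 : G), ∀ x : X, ∀ v ∈ V, F (v • x) = F x := by
  -- the «agreement set» is open and contains `tsupport F ×ˢ {1}`
  have hA : IsOpen {p : X × G | F (p.2 • p.1) = F p.1} := by
    have h1 : IsLocallyConstant fun p : X × G => F (p.2 • p.1) :=
      hF.comp_continuous (continuous_snd.smul continuous_fst)
    have h2 : IsLocallyConstant fun p : X × G => F p.1 := hF.comp_continuous continuous_fst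
    have h12 : IsLocallyConstant fun p : X × G => (F (p.2 • p.1), F p.1) := h1.prodMk h2
    have : {p : X × G | F (p.2 • p.1) = F p.1} = (fun p : X × G => (F (p.2 • p.1), F p.1)) ⁻¹' {q : Y × Y | q.1 = q.2} := by
      ext p; simp only [Set.mem_setOf_eq, Set.mem_preimage]
    rw [this]
    exact h12 _
  have hsub : tsupport F ×ˢ ({1} : Set G) ⊆ {p : X × G | F (p.2 • p.1) = F p.1} := by
    rintro ⟨x, v⟩ ⟨-, hv⟩
    simp only [Set.mem_singleton_iff] at hv
    simp only [Set.mem_setOf_eq, hv, one_smul]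
  obtain ⟨U₁, V₁, -, hV₁o, hTU₁, h1V₁, hUV⟩ := generalized_tube_lemma hFs isCompact_singleton hA hsub
  have h1 : (1 : G) ∈ V₁ := h1V₁ (Set.mem_singleton 1)
  have hT : ∀ x ∈ tsupport F, ∀ v ∈ V₁, F (v • x) = F x := fun x hx v hv => by
    have := hUV (Set.mk_mem_prod (hTU₁ hx) hv)
    simpa only [Set.mem_setOf_eq] using this
  refine ⟨V₁ ∩ V₁⁻¹, Filter.inter_mem (hV₁o.mem_nhds h1) (inv_mem_nhds_one G (hV₁o.mem_nhds h1)), fun x v hv => ?_⟩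
  by_cases hx : x ∈ tsupport F
  · exact hT x hx v hv.1
  · by_cases hvx : v • x ∈ tsupport F
    · have := hT (v • x) hvx v⁻¹ hv.2
      rw [inv_smul_smul] at this
      exact this.symm
    · rw [image_eq_zero_of_notMem_tsupport hx, image_eq_zero_of_notMem_tsupport hvx]

/-- **A LEVEL EXISTS**: if a family of sets `K i` enters every neighbourhood of `1`, a locally constant compactly supported `F` on a `G`-space is
invariant under some `K i`. [cite: BernsteinZelevinsky1976, §1.1] -/
theorem exists_forall_smul_eq_of_hasCompactSupport_of_basis {ι : Sort*} {K : ι → Set G} (hK : ∀ V ∈ 𝓝 (1 : G), ∃ i, K i ⊆ V)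
    {F : X → Y} (hF : IsLocallyConstant F) (hFs : HasCompactSupport F) :
    ∃ i, ∀ x : X, ∀ u ∈ K i, F (u • x) = F x := by
  obtain ⟨V, hV, h⟩ := exists_nhds_one_forall_smul_eq_of_hasCompactSupport (G := G) hF hFs
  obtain ⟨i, hi⟩ := hK V hV
  exact ⟨i, fun x u hu => h x u (hi hu)⟩

end Uniform

/-! ## §2 The orbits of an open subgroup are open and closed cells; finitely many in a stable compact set -/

section Cells

variable {G : Type*} [Group G] [TopologicalSpace G] {X : Type*} [TopologicalSpace X] [MulAction G X]

omit [TopologicalSpace G] [TopologicalSpace X] in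
/-- The orbit of `x` under a subgroup `N` is the image of `N` under the orbit map of `x`. [cite: BernsteinZelevinsky1976, §1.5] -/
theorem orbit_subgroup_eq_image_coe (N : Subgroup G) (x : X) : orbit N x = (fun g : G => g • x) '' (N : Set G) := by
  ext y
  constructor
  · rintro ⟨n, rfl⟩
    exact ⟨n, n.2, rfl⟩
  · rintro ⟨g, hg, rfl⟩
    exact ⟨⟨g, hg⟩, rfl⟩

/-- **Orbits of an OPEN subgroup are open** when the orbit maps are open. [cite: BernsteinZelevinsky1976, §1.5] -/
theorem isOpen_orbit_subgroup (hopen : ∀ x : X, IsOpenMap fun g : G => g • x) (N : Subgroup G) (hN : IsOpen (N : Set G)) (x : X) :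
    IsOpen (orbit N x) := by
  rw [orbit_subgroup_eq_image_coe]
  exact hopen x _ hN

/-- **Orbits of an open subgroup are closed** (the complement is a union of orbits). [cite: BernsteinZelevinsky1976, §1.5] -/
theorem isClosed_orbit_subgroup (hopen : ∀ x : X, IsOpenMap fun g : G => g • x) (N : Subgroup G) (hN : IsOpen (N : Set G)) (x : X) :
    IsClosed (orbit N x) := by
  rw [← isOpen_compl_iff, isOpen_iff_forall_mem_open]
  intro y hy
  refine ⟨orbit N y, fun z hz hzx => hy ?_, isOpen_orbit_subgroup hopen N hN y, mem_orbit_self y⟩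
  rcases orbit.eq_or_disjoint (G := N) y x with h | h
  · rw [← h]; exact mem_orbit_self y
  · exact (Set.disjoint_left.1 h hz hzx).elim

/-- **Orbits of a compact subgroup are compact** when the orbit maps are continuous. [cite: BernsteinZelevinsky1976, §1.5] -/
theorem isCompact_orbit_subgroup (hcont : ∀ x : X, Continuous fun g : G => g • x) (N : Subgroup G) (hN : IsCompact (N : Set G)) (x : X) :
    IsCompact (orbit N x) := by
  rw [orbit_subgroup_eq_image_coe]
  exact hN.image (hcont x)

omit [TopologicalSpace G] [TopologicalSpace X] in
/-- The orbit of `x` under a subgroup `N ≤ M` lies in the `M`-orbit. [cite: BernsteinZelevinsky1976, §1.5] -/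
theorem orbit_subgroup_mono {N M : Subgroup G} (h : N ≤ M) (x : X) : orbit N x ⊆ orbit M x := by
  rintro _ ⟨n, rfl⟩
  exact ⟨⟨(n : G), h n.2⟩, rfl⟩

omit [TopologicalSpace G] in
/-- **FINITELY MANY CELLS.**  If the `N`-orbits are open, a compact set `S` meets only finitely many `N`-orbits — the set of orbit classes of its points is
finite (the orbits of the points of `S` form an open cover). [cite: BernsteinZelevinsky1976, §1.5] -/
theorem finite_image_orbitRel_mk_of_isCompact (N : Subgroup G) (hNo : ∀ x : X, IsOpen (orbit N x)) {S : Set X} (hS : IsCompact S) :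
    ((Quotient.mk (orbitRel N X)) '' S).Finite := by
  classical
  -- the open cover of `S` by the orbits of its points has a finite subcover; every orbit class of `S` occurs in it
  obtain ⟨t, htS, htf, hcov⟩ := hS.elim_finite_subcover_image (b := S) (c := fun x => orbit N x) (fun x _ => hNo x)
    (fun x hx => mem_iUnion₂.2 ⟨x, hx, mem_orbit_self x⟩)
  refine (htf.image (Quotient.mk (orbitRel N X))).subset ?_
  rintro _ ⟨x, hx, rfl⟩
  obtain ⟨y, hy, hxy⟩ := mem_iUnion₂.1 (hcov hx)
  -- `x ∈ orbit N y` is `orbitRel N X x y`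
  exact ⟨y, hy, (Quotient.sound (show (orbitRel N X) x y from orbitRel_apply.2 hxy)).symm⟩

omit [TopologicalSpace G] [TopologicalSpace X] in
/-- Distinct orbit classes have disjoint orbits. [cite: BernsteinZelevinsky1976, §1.5] -/
theorem pairwiseDisjoint_orbitRel_quotient_orbit (N : Subgroup G) (A : Set (orbitRel.Quotient N X)) :
    A.PairwiseDisjoint orbitRel.Quotient.orbit := by
  intro ω _ ω' _ hne
  refine Set.disjoint_left.2 fun a ha ha' => hne ?_
  rw [orbitRel.Quotient.mem_orbit] at ha ha'
  exact ha.symm.trans ha'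

omit [TopologicalSpace G] [TopologicalSpace X] in
/-- The class of `x` has orbit `N • x`. [cite: BernsteinZelevinsky1976, §1.5] -/
theorem orbitRel_quotient_orbit_mk_eq (N : Subgroup G) (x : X) :
    orbitRel.Quotient.orbit (Quotient.mk (orbitRel N X) x) = orbit N x :=
  orbitRel.Quotient.orbit_mk x

end Cells

/-! ## §3 Decomposition of an `N`-invariant compactly supported function into orbit cells -/

section Decomposition

variable {G : Type*} [Group G] {X : Type*} [TopologicalSpace X] [MulAction G X] {Y : Type*} [AddCommMonoid Y]

/-- **CELL DECOMPOSITION.**  If the orbits of the subgroup `N` are open and `F : X → Y` is compactly supported and `N`-INVARIANT (`F (n • x) = F x`),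
then `F` is the finite sum, over the (finitely many) `N`-orbit classes `ω` meeting `tsupport F`, of the cell functions `1_ω · F(out ω)`:
`F = Σ_{ω ∈ A} ω.orbit.indicator (fun _ => F ω.out)`.  [cite: BernsteinZelevinsky1976, §1.5–§1.6] -/
theorem exists_eq_finset_sum_indicator_orbit_of_forall_smul_eq (N : Subgroup G) (hNo : ∀ x : X, IsOpen (orbit N x)) {F : X → Y}
    (hFs : HasCompactSupport F) (hFN : ∀ n : G, n ∈ N → ∀ x : X, F (n • x) = F x) :
    ∃ A : Finset (orbitRel.Quotient N X), (∀ x ∈ tsupport F, Quotient.mk (orbitRel N X) x ∈ A) ∧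
      F = fun x => ∑ ω ∈ A, (orbitRel.Quotient.orbit ω).indicator (fun _ => F ω.out) x := by
  classical
  have hfin := finite_image_orbitRel_mk_of_isCompact (G := G) N hNo hFs
  refine ⟨hfin.toFinset, fun x hx => hfin.mem_toFinset.2 ⟨x, hx, rfl⟩, funext fun x => ?_⟩
  -- `F` is constant on `N`-orbits: `F (out ⟦x⟧) = F x`
  have hconst : ∀ ω : orbitRel.Quotient N X, ∀ y ∈ orbitRel.Quotient.orbit ω, F ω.out = F y := by
    intro ω y hy
    have hω : orbitRel.Quotient.orbit ω = orbit N ω.out := orbitRel.Quotient.orbit_eq_orbit_out ω Quotient.out_eq'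
    rw [hω] at hy
    obtain ⟨n, rfl⟩ := hy
    exact (hFN n n.2 ω.out).symm
  -- only the class of `x` contributes
  have hx : x ∈ orbitRel.Quotient.orbit (Quotient.mk (orbitRel N X) x) := by
    rw [orbitRel.Quotient.mem_orbit]
  by_cases hA : Quotient.mk (orbitRel N X) x ∈ hfin.toFinset
  · rw [Finset.sum_eq_single (Quotient.mk (orbitRel N X) x)]
    · rw [Set.indicator_of_mem hx]
      exact (hconst _ x hx).symm
    · intro ω _ hne
      exact Set.indicator_of_notMem (fun h => hne ((orbitRel.Quotient.mem_orbit.1 h).symm)) _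
    · exact fun h => (h hA).elim
  · -- `x ∉ tsupport F`: both sides vanish
    have hx0 : F x = 0 := image_eq_zero_of_notMem_tsupport fun h => hA (hfin.mem_toFinset.2 ⟨x, h, rfl⟩)
    rw [hx0, eq_comm]
    refine Finset.sum_eq_zero fun ω hω => ?_
    refine Set.indicator_of_notMem (fun h => hA ?_) _
    rwa [← (orbitRel.Quotient.mem_orbit.1 h)] at hω

end Decomposition

/-! ## §4 Normal refinement: the `N`-orbits inside an `M`-orbit are `M`-translates of one of them -/

section Refinement

variable {G : Type*} [Group G] [TopologicalSpace G] {X : Type*} [TopologicalSpace X] [MulAction G X]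

omit [TopologicalSpace G] [TopologicalSpace X] in
/-- **Translates of a cell.**  If `N` is normalised by `m` (both `m n m⁻¹ ∈ N` and `m⁻¹ n m ∈ N` for `n ∈ N`), then `N • (m • x) = m • (N • x)`.
[cite: BernsteinZelevinsky1976, §1.5] -/
theorem orbit_subgroup_smul_eq_smul_orbit (N : Subgroup G) {m : G} (hm : ∀ n ∈ N, m * n * m⁻¹ ∈ N) (hm' : ∀ n ∈ N, m⁻¹ * n * m ∈ N) (x : X) :
    orbit N (m • x) = m • orbit N x := by
  ext y
  constructor
  · rintro ⟨n, rfl⟩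
    refine ⟨(m⁻¹ * n * m) • x, ⟨⟨m⁻¹ * n * m, hm' n n.2⟩, rfl⟩, ?_⟩
    show m • (m⁻¹ * ↑n * m) • x = (n : G) • m • x
    rw [smul_smul, smul_smul, ← mul_assoc, ← mul_assoc, mul_inv_cancel, one_mul]
  · rintro ⟨_, ⟨n, rfl⟩, rfl⟩
    refine ⟨⟨m * n * m⁻¹, hm n n.2⟩, ?_⟩
    show (m * ↑n * m⁻¹) • m • x = m • (n : G) • x
    rw [smul_smul, smul_smul, inv_mul_cancel_right]

/-- **NORMAL REFINEMENT.**  `N ≤ M` subgroups with `N` normalised by `M`, the `N`-orbits open and `M` compact with continuous orbit maps.  Then the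
compact cell `M • x` is the disjoint union of FINITELY many `N`-cells, each an `M`-translate `m • (N • x)` of `N • x`, among them `N • x` itself.
[cite: BernsteinZelevinsky1976, §1.5] -/
theorem exists_finset_orbit_eq_biUnion_smul_orbit (hcont : ∀ x : X, Continuous fun g : G => g • x) {M N : Subgroup G}
    (hMc : IsCompact (M : Set G)) (hNo : ∀ x : X, IsOpen (orbit N x)) (hNM : N ≤ M) (hnorm : ∀ m ∈ M, ∀ n ∈ N, m * n * m⁻¹ ∈ N) (x : X) :
    ∃ A : Finset (orbitRel.Quotient N X), Quotient.mk (orbitRel N X) x ∈ A ∧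
      (∀ ω ∈ A, ∃ m : G, m ∈ M ∧ orbitRel.Quotient.orbit ω = m • orbit N x) ∧
      (↑A : Set (orbitRel.Quotient N X)).PairwiseDisjoint orbitRel.Quotient.orbit ∧
      orbit M x = ⋃ ω ∈ A, orbitRel.Quotient.orbit ω := by
  classical
  have hfin := finite_image_orbitRel_mk_of_isCompact (G := G) N hNo (isCompact_orbit_subgroup hcont M hMc x)
  refine ⟨hfin.toFinset, hfin.mem_toFinset.2 ⟨x, mem_orbit_self x, rfl⟩, fun ω hω => ?_,
    pairwiseDisjoint_orbitRel_quotient_orbit N _, ?_⟩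
  · obtain ⟨_, ⟨m, rfl⟩, rfl⟩ := hfin.mem_toFinset.1 hω
    refine ⟨(m : G), m.2, ?_⟩
    rw [orbitRel_quotient_orbit_mk_eq]
    exact orbit_subgroup_smul_eq_smul_orbit N (hnorm m m.2) (fun n hn => by
      simpa only [inv_inv] using hnorm (m : G)⁻¹ (M.inv_mem m.2) n hn) x
  · ext y
    simp only [Set.mem_iUnion, Set.Finite.mem_toFinset, Set.mem_image, exists_prop]
    constructor
    · intro hy
      exact ⟨Quotient.mk (orbitRel N X) y, ⟨y, hy, rfl⟩, by rw [orbitRel.Quotient.mem_orbit]⟩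
    · rintro ⟨ω, ⟨z, hz, rfl⟩, hyω⟩
      rw [orbitRel_quotient_orbit_mk_eq] at hyω
      obtain ⟨n, rfl⟩ := hyω
      obtain ⟨m, rfl⟩ := hz
      refine ⟨⟨(n : G), hNM n.2⟩ * m, ?_⟩
      show ((⟨(n : G), hNM n.2⟩ * m : M) : G) • x = (n : G) • (m : G) • x
      rw [Subgroup.coe_mul, mul_smul]

end Refinement

end Literature.Topology
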